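import Summits.RiemannHypothesis.RiemannHypothesis.Theorems.JensenLogBandArcSaddleDen
import Mathlib.Analysis.Complex.Liouville
import HarnessLib

/-!
# `λ‴ = O(1/T)` on the band (BAND line, input of step S4b)

RH ladder column JENSEN, rung J-P(P3) «log band», BAND crux `XiDerivBandRealAllRates` of route
«JensenLogBand», line «band-one-window» (u-arc reshape), lead rh-jensen-prover g7 — step (d) of the
S4b recipe in HOME/rh-jensen-prover/g7-work/LINE-PLAN.md §8.4. RH-FREE (Γ-factor only). WHAT THIS
IS NOT: nothing here bears on zeros of `ζ` or the truth of RH.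

With `λ″(s) := −1/s² − 1/(s−1)² + ¼ψ′(s/2)` (the derivative of eng-2 g5's explicit
`λ′ = 1/s + 1/(s−1) − ½log π + ½ψ(s/2)`, `hasDerivAt_xiGammaLogDeriv`) and their band bound
`‖λ″(s) − 1/(2s)‖ ≤ 6/Im s` (`Im s ≥ 4`, `Re s ≥ 0`), Cauchy's estimate on the circle of radius
`1/5` about `s` gives, for `Im s ≥ 5`, `Re s ≥ 1/5`:

  `‖λ‴(s) + 1/(2s²)‖ ≤ 30/(Im s − 1/5)`   (`norm_deriv_lamPrime2_add_le`),

so `λ‴ = O(1/T)` on the window of the saddle arc — all that the cubic remainder needs (§8.4 (c)).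
-/

noncomputable section

-- single-problem summit: `Summit.RiemannHypothesis.RiemannHypothesis.…` is the tree convention
set_option linter.dupNamespace false

open Complex Real Set Metric

namespace Summit.RiemannHypothesis.RiemannHypothesis.Theorems.JensenPolynomials.LogBandArc

open Literature.NumberTheory.LFunctions

/-- eng-2 g5's explicit `λ″(s) = −1/s² − 1/(s−1)² + ¼ ψ′(s/2)`. [folklore] -/
def lamPrime2 (s : ℂ) : ℂ := -1 / s ^ 2 - 1 / (s - 1) ^ 2 + deriv Complex.digamma (s / 2) / 4

/-- `λ″` is differentiable on the upper half-plane. [folklore] -/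
theorem differentiableOn_lamPrime2 : DifferentiableOn ℂ lamPrime2 {z : ℂ | 0 < z.im} := by
  have hU : IsOpen {z : ℂ | 0 < z.im} := isOpen_lt continuous_const Complex.continuous_im
  have hψ' : AnalyticOnNhd ℂ (deriv Complex.digamma) {z : ℂ | 0 < z.im} :=
    (Literature.Analysis.SpecialFunctions.Complex.differentiableOn_digamma_im_pos.analyticOnNhd
      hU).deriv
  intro z hz
  have hz' : 0 < z.im := hz
  have hz0 : z ≠ 0 := fun h => by rw [h] at hz'; simp at hz'
  have hz1 : z - 1 ≠ 0 := by
    intro h; have := congrArg Complex.im h; simp at this; exact absurd this (ne_of_gt hz')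
  have hz2 : 0 < (z / 2).im := by
    have : (z / 2).im = z.im / 2 := by simp
    rw [this]; linarith
  have hψd : DifferentiableAt ℂ (deriv Complex.digamma) (z / 2) := (hψ' (z / 2) hz2).differentiableAt
  have hd : DifferentiableAt ℂ (fun w : ℂ => deriv Complex.digamma (w / 2)) z := by
    have hlin : DifferentiableAt ℂ (fun w : ℂ => w / 2) z := differentiableAt_id.div_const _
    have := hψd.comp z hlin
    simpa [Function.comp_def] using this
  unfold lamPrime2
  apply DifferentiableAt.differentiableWithinAt
  have h1 : DifferentiableAt ℂ (fun w : ℂ => -1 / w ^ 2) z :=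
    (differentiableAt_const _).div (differentiableAt_id.pow 2) (pow_ne_zero 2 hz0)
  have h2 : DifferentiableAt ℂ (fun w : ℂ => 1 / (w - 1) ^ 2) z :=
    (differentiableAt_const _).div ((differentiableAt_id.sub_const 1).pow 2) (pow_ne_zero 2 hz1)
  exact (h1.sub h2).add (hd.div_const 4)

/-- **`λ‴ = −1/(2s²) + O(1/Im s)`:** for `Im s ≥ 5` and `Re s ≥ 1/5`,
`‖deriv λ″ (s) + 1/(2s²)‖ ≤ 30/(Im s − 1/5)` (Cauchy's estimate on the circle of radius `1/5`
about `s`, where `‖λ″(z) − 1/(2z)‖ ≤ 6/Im z`). [folklore] -/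
theorem norm_deriv_lamPrime2_add_le {s : ℂ} (him : 5 ≤ s.im) (hre : 1 / 5 ≤ s.re) :
    ‖deriv lamPrime2 s + 1 / (2 * s ^ 2)‖ ≤ 30 / (s.im - 1 / 5) := by
  set g : ℂ → ℂ := fun z => lamPrime2 z - 1 / (2 * z) with hg
  have hU : IsOpen {z : ℂ | 0 < z.im} := isOpen_lt continuous_const Complex.continuous_im
  have hgdiff : DifferentiableOn ℂ g {z : ℂ | 0 < z.im} := by
    refine differentiableOn_lamPrime2.sub ?_
    intro z hz
    have hz0 : z ≠ 0 := fun h => by rw [h] at hz; simp at hz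
    exact ((differentiableAt_const _).div (differentiableAt_id.const_mul 2)
      (mul_ne_zero two_ne_zero hz0)).differentiableWithinAt
  have hsub : closedBall s (1 / 5) ⊆ {z : ℂ | 0 < z.im} := by
    intro z hz
    have hz' : ‖z - s‖ ≤ 1 / 5 := mem_closedBall_iff_norm.1 hz
    have : |(z - s).im| ≤ 1 / 5 := le_trans (Complex.abs_im_le_norm _) hz'
    rw [Complex.sub_im, abs_le] at this
    show 0 < z.im
    linarith [this.1]
  have hdc : DiffContOnCl ℂ g (ball s (1 / 5)) := by
    refine DifferentiableOn.diffContOnCl ?_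
    rw [closure_ball s (by norm_num)]
    exact hgdiff.mono hsub
  have hs5 : 0 < s.im - 1 / 5 := by linarith
  have hC : ∀ z ∈ sphere s (1 / 5), ‖g z‖ ≤ 6 / (s.im - 1 / 5) := by
    intro z hz
    have hz' : ‖z - s‖ = 1 / 5 := mem_sphere_iff_norm.1 hz
    have hzi : |(z - s).im| ≤ 1 / 5 := le_trans (Complex.abs_im_le_norm _) hz'.le
    have hzr : |(z - s).re| ≤ 1 / 5 := le_trans (Complex.abs_re_le_norm _) hz'.le
    rw [Complex.sub_im, abs_le] at hzi
    rw [Complex.sub_re, abs_le] at hzr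
    have hzim : s.im - 1 / 5 ≤ z.im := by linarith [hzi.1]
    have hb := norm_xiGammaLogDeriv2_sub_le_of_re_nonneg (s := z) (by linarith) (by linarith)
    calc ‖g z‖ = ‖(-1 / z ^ 2 - 1 / (z - 1) ^ 2 + deriv Complex.digamma (z / 2) / 4) - 1 / (2 * z)‖ := by
          simp only [hg, lamPrime2]
      _ ≤ 6 / z.im := hb
      _ ≤ 6 / (s.im - 1 / 5) := div_le_div_of_nonneg_left (by norm_num) hs5 hzim
  have hest := Complex.norm_deriv_le_of_forall_mem_sphere_norm_le (by norm_num) hdc hC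
  -- `deriv g s = deriv λ″ s + 1/(2 s²)`
  have hsim : 0 < s.im := by linarith
  have hs0 : s ≠ 0 := fun h => by rw [h] at hsim; simp at hsim
  have hL : DifferentiableAt ℂ lamPrime2 s := (differentiableOn_lamPrime2 s hsim).differentiableAt
    (hU.mem_nhds hsim)
  have hinv : HasDerivAt (fun z : ℂ => 1 / (2 * z)) (-(1 / (2 * s ^ 2))) s := by
    have h1 : HasDerivAt (fun z : ℂ => (2 * z)⁻¹) (-(2 * 1) / (2 * s) ^ 2) s := by
      have := ((hasDerivAt_id s).const_mul (2 : ℂ)).fun_inv (mul_ne_zero two_ne_zero hs0)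
      simpa using this
    refine (h1.congr_of_eventuallyEq (Filter.Eventually.of_forall fun z => by simp [one_div])).congr_deriv ?_
    field_simp
  have hderiv : deriv g s = deriv lamPrime2 s + 1 / (2 * s ^ 2) := by
    have h1 : HasDerivAt g (deriv lamPrime2 s - -(1 / (2 * s ^ 2))) s := hL.hasDerivAt.sub hinv
    rw [h1.deriv]; ring
  rw [hderiv] at hest
  calc ‖deriv lamPrime2 s + 1 / (2 * s ^ 2)‖ ≤ 6 / (s.im - 1 / 5) / (1 / 5) := hest
    _ = 30 / (s.im - 1 / 5) := by field_simp; ring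

/-- `λ″ = lamPrime2` is the derivative of `lamPrime` (eng-2 g5's `hasDerivAt_xiGammaLogDeriv`, named
form). [folklore] -/
theorem hasDerivAt_lamPrime {s : ℂ} (him : 0 < s.im) : HasDerivAt lamPrime (lamPrime2 s) s := by
  unfold lamPrime lamPrime2
  exact hasDerivAt_xiGammaLogDeriv him

end Summit.RiemannHypothesis.RiemannHypothesis.Theorems.JensenPolynomials.LogBandArc

end
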